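import Summits.Ventures.PercRepro.C041PortProblemCaseV

/-!
# The port problem of THEOREM R: CASE (v), the sums — `Φ (P.sub p) ≤ Φ P` for a unique type-`{1}` gate (p6, gen 23)

Setting of `C041PortProblemCaseV`.  With the pattern correspondence `patternEquiv` the weight sum of `P` is the sum
over the patterns `x′` of the sub-problem of the two colours of the gate edge: red gives `3·[Good₁′ x′] + 1` (valid),
blue gives `3·[Good₂′ x′] − 2` (valid iff `x′` is).  Pointwise this dominates the sub-problem's summand
`3·[Good₁′] + 3·[Good₂′] − 2`, hence `phiOr_sub_le` / `phiAnd_sub_le`: `Φ (P.sub p) ≤ Φ P` — the paper's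
`Φ = N′ + Φ′` (exact for `V_∨`) as an inequality.
-/

namespace PercRepro

namespace PortProblem

namespace Problem

open Finset

variable {V : Type*} [DecidableEq V] {P : Problem V} {p : V}

section Weights

variable (hp : P.IsGate p) (huniq : ∀ g, P.IsGate g → g = p) (hk₁ : P.k₁ p = true) (hk₂ : P.k₂ p = false)

include hp huniq hk₁ hk₂ in
open Classical in
/-- The weight with the gate edge red. -/
theorem weight_extend_true (x' : (P.sub p).Term → Bool) :
    P.weight (P.extend p x' true) = (if (P.sub p).Good₁ x' then 3 else 0) + 1 := by
  unfold weight
  rw [if_pos (good₂_extend_true hp hk₁ hk₂ x')]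
  by_cases h : (P.sub p).Good₁ x'
  · rw [if_pos h, if_pos ((good₁_extend_true_iff hp huniq hk₂ x').2 h)]
    norm_num
  · rw [if_neg h, if_neg (fun h' => h ((good₁_extend_true_iff hp huniq hk₂ x').1 h'))]
    norm_num

include hp huniq hk₁ hk₂ in
open Classical in
/-- The weight with the gate edge blue. -/
theorem weight_extend_false (x' : (P.sub p).Term → Bool) :
    P.weight (P.extend p x' false) = (if (P.sub p).Good₂ x' then 3 else 0) - 2 := by
  unfold weight
  rw [if_neg (not_good₁_extend_false hp huniq hk₁ x')]
  by_cases h : (P.sub p).Good₂ x'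
  · rw [if_pos h, if_pos ((good₂_extend_false_iff hp huniq hk₁ hk₂ x').2 h)]
    norm_num
  · rw [if_neg h, if_neg (fun h' => h ((good₂_extend_false_iff hp huniq hk₁ hk₂ x').1 h'))]
    norm_num

end Weights

section Sums

variable [Fintype V]
variable (hp : P.IsGate p) (huniq : ∀ g, P.IsGate g → g = p) (hk₁ : P.k₁ p = true) (hk₂ : P.k₂ p = false)
  (hsw : P.sw p = true)

open Classical in
/-- The pattern sum of `P` as a sum over the sub-problem's patterns and the colour of the gate edge. -/
theorem sum_patterns_eq (hpM : p ∈ P.M) (hk₁ : P.k₁ p = true) (hk₂ : P.k₂ p = false)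
    (f : (P.Term → Bool) → ℤ) :
    ∑ x : P.Term → Bool, f x =
      ∑ x' : (P.sub p).Term → Bool, (f (P.extend p x' true) + f (P.extend p x' false)) := by
  rw [← (patternEquiv hpM hk₁ hk₂).symm.sum_comp f]
  rw [Fintype.sum_prod_type]
  apply Finset.sum_congr rfl
  intro x' _
  rw [Fintype.sum_bool]
  rfl

include hp huniq hk₁ hk₂ hsw in
open Classical in
/-- **CASE (v), `Φ∨`**: `Φ∨ (P.sub p) ≤ Φ∨ P` for a unique switchable gate of type `{1}`. -/
theorem phiOr_sub_le : (P.sub p).phiOr ≤ P.phiOr := by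
  unfold phiOr
  rw [sum_patterns_eq hp.mem hk₁ hk₂]
  apply Finset.sum_le_sum
  intro x' _
  rw [weight_extend_true hp huniq hk₁ hk₂, weight_extend_false hp huniq hk₁ hk₂]
  have hadmT := adm_extend_iff hk₂ hsw x' true
  have hadmF := adm_extend_iff hk₂ hsw x' false
  have hX₁T := X₁_extend_true hk₁ hp.mem x'
  have hX₁F := X₁_extend_false_iff hk₁ hk₂ hp.mem x'
  have hX₂F := X₂_extend_iff hk₂ x' false
  simp only [hadmT, hadmF, hX₁T, hX₁F, hX₂F, true_or, and_true, weight]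
  split_ifs <;> first | omega | (exfalso; tauto)

include hp huniq hk₁ hk₂ hsw in
open Classical in
/-- **CASE (v), `Φ∧`**: `Φ∧ (P.sub p) ≤ Φ∧ P` for a unique switchable gate of type `{1}`. -/
theorem phiAnd_sub_le : (P.sub p).phiAnd ≤ P.phiAnd := by
  unfold phiAnd
  rw [sum_patterns_eq hp.mem hk₁ hk₂]
  apply Finset.sum_le_sum
  intro x' _
  rw [weight_extend_true hp huniq hk₁ hk₂, weight_extend_false hp huniq hk₁ hk₂]
  have hadmT := adm_extend_iff hk₂ hsw x' true
  have hadmF := adm_extend_iff hk₂ hsw x' false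
  have hX₁T := X₁_extend_true hk₁ hp.mem x'
  have hX₁F := X₁_extend_false_iff hk₁ hk₂ hp.mem x'
  have hX₂T := X₂_extend_iff hk₂ x' true
  have hX₂F := X₂_extend_iff hk₂ x' false
  simp only [hadmT, hadmF, hX₁T, hX₁F, hX₂T, hX₂F, true_and, weight]
  split_ifs <;> first | omega | (exfalso; tauto)

end Sums

end Problem

end PortProblem

end PercRepro
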